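import Literature.AlgebraicGeometry.Resolution.BlowupChartTransition
import Literature.AlgebraicGeometry.Resolution.BlowupChartRegular
import Literature.AlgebraicGeometry.Resolution.HypersurfaceTransform
import Mathlib
import HarnessLib

/-!
# [OURS · L1 W4.5(b) · EL♮(3) · door ν4, D7 brick HNODE, core P5] THE BLOW-UP OF A SPLIT NODE IS REGULAR OVER THE NODE — ring core

res-L1-w45b-stub-2 g17 (HNODE pen). `--supports stmt-ResolutionOfSingularities-20148 --as helper`, no claim, counted 0. OURS; NOT a statement of
[Hironaka2017]; AI-written, weaker than expert review. EL♮(3) is NOT proved here; char-p resolution is NOT proved anywhere in this tree. DEF-FREE.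

The ring core of P5 (`hNode` of `Equinodal.hnode_rPlus_of_core`): let `(D, 𝔪)` be a Noetherian local ring with `𝔪 = (U, V)` and a relation
`α U² + β UV + γ V² + η = 0`, `η ∈ 𝔪³`, `β² − 4αγ` a unit (the local ring of a reduced curve at a SPLIT NODE; no dimension hypothesis, every
characteristic).  On the chart `B = D[𝔪/V] ⊆ D[1/V]` of the blow-up of `𝔪`, at every prime `𝔔` over `𝔪`:
* `aeval_eq_zero_or_isUnit_of_simple_root` — in a LOCAL algebra over a field, polynomials evaluated at a SIMPLE root of a quadratic are `0` or units
  (minimal polynomial of the residue; the cofactor is a unit);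
* ★ `maximalIdeal_localization_eq_span` — `𝔪_{B_𝔔} = (V)` (`α w² + β w + γ ∈ V·B` for `w = U/V`, and modulo `V` every element of `𝔔` is a polynomial
  in `w` over the residue field vanishing at a simple root of `ᾱX² + β̄X + γ̄`); ★ `isRegularLocalRing_localization` — `B_𝔔` is a regular local ring
  (`B_𝔔/(V)` is a field and `V` is a nonzerodivisor of `B`: tree `isRegularLocalRing_of_quotient_span_singleton`).
-/

set_option linter.dupNamespace false

noncomputable section

open IsLocalRing Polynomial
open Literature.AlgebraicGeometry.Resolution

namespace Summit.ResolutionOfSingularities.ResolutionOfSingularities.Cruxes.EquisingularLiftNat.Sections.Equinodal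

namespace SplitNodeChart

universe u

/-! ## Simple roots of a quadratic in a local algebra over a field -/

/-- **At a simple root of a quadratic, polynomials are zero or units.**  Let `L` be a local algebra over a field `κ`, `ω ∈ L` with
`a ω² + b ω + c = 0` and `b² − 4ac ≠ 0` in `κ`.  Then `p(ω)` is `0` or a unit for every `p ∈ κ[X]`. [folklore] -/
theorem aeval_eq_zero_or_isUnit_of_simple_root {κ L : Type u} [Field κ] [CommRing L] [IsLocalRing L] [Algebra κ L]
    (a b c : κ) (hdisc : b ^ 2 - 4 * a * c ≠ 0) (ω : L) (hω : aeval ω (C a * X ^ 2 + C b * X + C c) = 0) (p : κ[X]) :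
    aeval ω p = 0 ∨ IsUnit (aeval ω p) := by
  classical
  by_cases hu : IsUnit (aeval ω p)
  · exact Or.inr hu
  left
  set Q : κ[X] := C a * X ^ 2 + C b * X + C c with hQ
  -- the residue map as a `κ`-algebra map
  letI : Algebra κ (ResidueField L) := ((residue L).comp (algebraMap κ L)).toAlgebra
  let ρ : L →ₐ[κ] ResidueField L := { residue L with commutes' := fun r => rfl }
  have hρ : ∀ x, ρ x = residue L x := fun x => rfl
  have hres : ∀ q : κ[X], residue L (aeval ω q) = aeval (ρ ω) q := fun q => by
    rw [← hρ, Polynomial.aeval_algHom_apply]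
  set ω₀ := ρ ω with hω₀
  have hQ₀ : aeval ω₀ Q = 0 := by rw [hω₀, ← hres, hω, map_zero]
  have hp₀ : aeval ω₀ p = 0 := by
    rw [hω₀, ← hres, residue_eq_zero_iff]; exact (mem_maximalIdeal _).mpr hu
  -- the minimal polynomial `μ` of `ω₀` divides `p` and `Q`
  obtain ⟨p₁, hp₁⟩ := minpoly.dvd κ ω₀ hp₀
  obtain ⟨ν, hν⟩ := minpoly.dvd κ ω₀ hQ₀
  -- `ν(ω₀) ≠ 0`: otherwise `μ² ∣ Q` and `ω₀` is a double root, killing the discriminant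
  have hν₀ : aeval ω₀ ν ≠ 0 := by
    intro h0
    obtain ⟨ν', hν'⟩ := minpoly.dvd κ ω₀ h0
    have hQ' : aeval ω₀ (derivative Q) = 0 := by
      rw [hν, hν', derivative_mul, derivative_mul]
      simp only [map_add, map_mul, minpoly.aeval, zero_mul, mul_zero, add_zero]
    have hder : derivative Q = C a * (C 2 * X) + C b := by
      rw [hQ]; simp only [derivative_add, derivative_mul, derivative_C, zero_mul, derivative_X_pow, derivative_X, derivative_C,
        mul_one, zero_add, add_zero, map_ofNat, Nat.cast_ofNat]
      ring
    rw [hder] at hQ'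
    rw [hQ] at hQ₀
    simp only [map_add, map_mul, aeval_C, aeval_X, map_pow, map_ofNat] at hQ' hQ₀
    -- `b² − 4ac = (2aω₀ + b)² − 4a(aω₀² + bω₀ + c)` vanishes in the residue field
    have key : algebraMap κ (ResidueField L) (b ^ 2 - 4 * a * c) = 0 := by
      have h : algebraMap κ (ResidueField L) (b ^ 2 - 4 * a * c) =
          (algebraMap κ _ a * (2 * ω₀) + algebraMap κ _ b) ^ 2 -
            4 * algebraMap κ _ a * (algebraMap κ _ a * ω₀ ^ 2 + algebraMap κ _ b * ω₀ + algebraMap κ _ c) := by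
        simp only [map_sub, map_mul, map_pow, map_ofNat]; ring
      rw [h, hQ₀, hQ', mul_zero, zero_pow two_ne_zero, sub_zero]
    exact hdisc ((algebraMap κ (ResidueField L)).injective (key.trans (map_zero _).symm))
  -- so `ν(ω)` is a unit and `μ(ω) = 0`
  have hνu : IsUnit (aeval ω ν) := by
    rw [← residue_ne_zero_iff_isUnit, hres]; exact hν₀
  have hμ : aeval ω (minpoly κ ω₀) = 0 := by
    have h : aeval ω (minpoly κ ω₀) * aeval ω ν = 0 := by rw [← map_mul, ← hν, hω]
    exact (hνu.mul_left_eq_zero).mp h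
  rw [hp₁, map_mul, hμ, zero_mul]

/-! ## The chart `D[𝔪/V]` at a split node -/

section Chart

variable {D : Type u} [CommRing D] [IsLocalRing D] [IsNoetherianRing D] (U V α β γ η : D)

omit [IsNoetherianRing D] in
/-- **The blow-up of a split node is regular over the node, chart `V ≠ 0`: the maximal ideal of `D[𝔪/V]_𝔔` is `(V)`** for every prime `𝔔` of the chart
over `𝔪 = (U, V)`, given `α U² + β UV + γ V² + η = 0` with `η ∈ 𝔪³` and `β² − 4αγ` a unit. [folklore; cf. de Jong 1996, 3.4 (ii) charts] -/
theorem maximalIdeal_localization_eq_span (h𝔪 : maximalIdeal D = Ideal.span {U, V}) (hrel : α * U ^ 2 + β * U * V + γ * V ^ 2 + η = 0)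
    (hη : η ∈ Ideal.span {U, V} ^ 3) (hdisc : IsUnit (β ^ 2 - 4 * α * γ))
    (𝔔 : Ideal (blowupAlgebra (Ideal.span {U, V}) V)) [𝔔.IsPrime]
    (h𝔔 : 𝔔.comap (algebraMap D (blowupAlgebra (Ideal.span {U, V}) V)) = maximalIdeal D)
    (L : Type u) [CommRing L] [Algebra (blowupAlgebra (Ideal.span {U, V}) V) L] [IsLocalization.AtPrime L 𝔔] [IsLocalRing L] :
    maximalIdeal L =
      Ideal.span {algebraMap (blowupAlgebra (Ideal.span {U, V}) V) L (algebraMap D (blowupAlgebra (Ideal.span {U, V}) V) V)} := by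
  classical
  have hUI : U ∈ Ideal.span {U, V} := Ideal.subset_span (by simp)
  have hVI : V ∈ Ideal.span {U, V} := Ideal.subset_span (by simp)
  -- notation-free abbreviations
  obtain ⟨B, hB⟩ : ∃ B : Subalgebra D (Localization.Away V), B = blowupAlgebra (Ideal.span {U, V}) V := ⟨_, rfl⟩
  subst hB
  set φD := algebraMap D (blowupAlgebra (Ideal.span {U, V}) V) with hφD
  set φL := algebraMap (blowupAlgebra (Ideal.span {U, V}) V) L with hφL
  set v : blowupAlgebra (Ideal.span {U, V}) V := φD V with hv
  set w : blowupAlgebra (Ideal.span {U, V}) V :=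
    ⟨algebraMap D (Localization.Away V) U * IsLocalization.Away.invSelf V, div_mem_blowupAlgebra _ V hUI⟩ with hw
  have hUw : φD U = w * v := Subtype.ext (by
    change algebraMap D (Localization.Away V) U = (algebraMap D _ U * IsLocalization.Away.invSelf V) * algebraMap D _ V
    rw [div_mul_algebraMap])
  have hIB : (Ideal.span {U, V}).map φD = Ideal.span {v} := map_blowupAlgebra_eq_span hVI
  have h𝔪B : (maximalIdeal D).map φD = Ideal.span {v} := by rw [h𝔪, hIB]
  have hv𝔔 : v ∈ 𝔔 := by
    have : V ∈ 𝔔.comap φD := by rw [h𝔔, h𝔪]; exact hVI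
    exact this
  have hv0 : v ∈ nonZeroDivisors (blowupAlgebra (Ideal.span {U, V}) V) := algebraMap_mem_nonZeroDivisors_blowupAlgebra
  -- `η = η₁ v³` in `B`
  have hη' : φD η ∈ Ideal.span {v ^ 3} := by
    have h := Ideal.mem_map_of_mem φD hη
    rwa [Ideal.map_pow, hIB, Ideal.span_singleton_pow] at h
  obtain ⟨η₁, hη₁⟩ := Ideal.mem_span_singleton'.mp hη'
  -- the quadratic `α w² + β w + γ = -η₁ v ∈ (v)`
  have hquad : φD α * w ^ 2 + φD β * w + φD γ = -(η₁ * v) := by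
    have h := congrArg φD hrel
    rw [map_add, map_add, map_add, map_mul, map_mul, map_mul, map_mul, map_pow, map_pow, map_zero, hUw, ← hη₁] at h
    have h2 : (φD α * w ^ 2 + φD β * w + φD γ + η₁ * v) * v ^ 2 = 0 := by rw [← h]; ring
    have h3 : φD α * w ^ 2 + φD β * w + φD γ + η₁ * v = 0 :=
      (mul_right_mem_nonZeroDivisors_eq_zero_iff ((nonZeroDivisors _).pow_mem hv0 2)).mp h2
    exact eq_neg_of_add_eq_zero_left h3
  -- `t = v/1 ∈ 𝔪_L`, and `L̄ = L/(t)`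
  set t : L := φL v with ht
  have ht𝔪 : t ∈ maximalIdeal L := (IsLocalization.AtPrime.to_map_mem_maximal_iff L 𝔔 v).mpr hv𝔔
  have hTne : Ideal.span {t} ≠ ⊤ := fun h =>
    (maximalIdeal.isMaximal L).ne_top (top_le_iff.mp (h ▸ (Ideal.span_le.mpr (Set.singleton_subset_iff.mpr ht𝔪))))
  haveI : Nontrivial (L ⧸ Ideal.span {t}) := Ideal.Quotient.nontrivial_iff.mpr hTne
  haveI : IsLocalRing (L ⧸ Ideal.span {t}) := IsLocalRing.of_surjective' (Ideal.Quotient.mk _) Ideal.Quotient.mk_surjective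
  set ψ : blowupAlgebra (Ideal.span {U, V}) V →+* L ⧸ Ideal.span {t} := (Ideal.Quotient.mk _).comp φL with hψ
  have hψv : ψ v = 0 := by
    rw [hψ, RingHom.comp_apply, ← ht]; exact Ideal.Quotient.eq_zero_iff_mem.mpr (Ideal.mem_span_singleton_self t)
  -- `D → L̄` kills `𝔪_D`: the residue field `κ` acts on `L̄`
  have hkill : ∀ m ∈ maximalIdeal D, (ψ.comp φD) m = 0 := by
    intro m hm
    have h1 : φD m ∈ Ideal.span {v} := h𝔪B ▸ Ideal.mem_map_of_mem φD hm
    obtain ⟨m₁, hm₁⟩ := Ideal.mem_span_singleton'.mp h1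
    rw [RingHom.comp_apply, ← hm₁, map_mul, hψv, mul_zero]
  set φκ : ResidueField D →+* L ⧸ Ideal.span {t} := Ideal.Quotient.lift (maximalIdeal D) (ψ.comp φD) hkill with hφκ
  letI : Algebra (ResidueField D) (L ⧸ Ideal.span {t}) := φκ.toAlgebra
  have hφκ' : ∀ d : D, algebraMap (ResidueField D) (L ⧸ Ideal.span {t}) (residue D d) = ψ (φD d) := fun d => rfl
  -- the image `ω` of `w` is a root of the reduced quadratic, whose discriminant is non-zero
  set ω := ψ w with hω
  have hωroot : aeval ω (C (residue D α) * X ^ 2 + C (residue D β) * X + C (residue D γ)) = 0 := by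
    simp only [map_add, map_mul, map_pow, aeval_C, aeval_X, hφκ']
    rw [hω, ← map_pow, ← map_mul, ← map_mul, ← map_add, ← map_add, hquad, map_neg, map_mul, hψv, mul_zero, neg_zero]
  have hdisc' : residue D β ^ 2 - 4 * residue D α * residue D γ ≠ 0 := by
    have h := hdisc.map (residue D)
    simp only [map_sub, map_mul, map_pow, map_ofNat] at h
    exact h.ne_zero
  -- every element of `B` is a polynomial in `w` over `D`
  have hgen : ∀ q : blowupAlgebra (Ideal.span {U, V}) V, ∃ P : D[X], aeval w P = q := by
    intro q
    have hadj : blowupAlgebra (Ideal.span {U, V}) V =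
        Algebra.adjoin D ((fun x => algebraMap D (Localization.Away V) x * IsLocalization.Away.invSelf V) '' {U, V}) :=
      blowupAlgebra_eq_adjoin_of_span_eq _ V rfl
    have hq : (q : Localization.Away V) ∈ Algebra.adjoin D {(w : Localization.Away V)} := by
      have hq0 := hadj.le q.2
      refine Algebra.adjoin_le ?_ hq0
      rintro _ ⟨x, hx, rfl⟩
      rcases hx with rfl | hx
      · exact Algebra.subset_adjoin rfl
      · rw [Set.mem_singleton_iff] at hx
        subst hx
        change algebraMap D (Localization.Away x) x * IsLocalization.Away.invSelf x ∈ _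
        rw [IsLocalization.Away.mul_invSelf]; exact Subalgebra.one_mem _
    rw [Algebra.adjoin_singleton_eq_range_aeval] at hq
    obtain ⟨P, hP⟩ := hq
    refine ⟨P, Subtype.ext ?_⟩
    rw [Polynomial.aeval_subalgebra_coe P (blowupAlgebra (Ideal.span {U, V}) V) w]
    exact hP
  -- `𝔪_L = 𝔔 L ⊆ (t)`
  apply le_antisymm
  · rw [← IsLocalization.AtPrime.map_eq_maximalIdeal 𝔔 L, Ideal.map_le_iff_le_comap]
    intro q hq
    obtain ⟨P, rfl⟩ := hgen q
    rw [Ideal.mem_comap, ← Ideal.Quotient.eq_zero_iff_mem]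
    change ψ (aeval w P) = 0
    have hev : ψ (aeval w P) = aeval ω (P.map (residue D)) := by
      rw [aeval_def, Polynomial.hom_eval₂, aeval_def, Polynomial.eval₂_map]
      rfl
    rw [hev]
    rcases aeval_eq_zero_or_isUnit_of_simple_root _ _ _ hdisc' ω hωroot (P.map (residue D)) with h0 | hunit
    · exact h0
    · exfalso
      rw [← hev] at hunit
      have hmem : φL (aeval w P) ∈ maximalIdeal L := (IsLocalization.AtPrime.to_map_mem_maximal_iff L 𝔔 _).mpr hq
      have hmem' : ψ (aeval w P) ∈ maximalIdeal (L ⧸ Ideal.span {t}) := by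
        rw [← IsLocalRing.map_maximalIdeal_of_surjective (Ideal.Quotient.mk (Ideal.span {t})) Ideal.Quotient.mk_surjective]
        exact Ideal.mem_map_of_mem _ hmem
      exact (mem_maximalIdeal _).mp hmem' hunit
  · rw [Ideal.span_le, Set.singleton_subset_iff]; exact ht𝔪

/-- ★ **The blow-up of a split node is regular over the node** (chart `V ≠ 0`): `D[𝔪/V]_𝔔` is a regular local ring at every prime `𝔔` over `𝔪`. Its
maximal ideal is `(V)` by `maximalIdeal_localization_eq_span`, `V` is a nonzerodivisor of the chart, and the quotient is a field.
[folklore; cf. de Jong 1996, 3.4 (ii)] -/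
theorem isRegularLocalRing_localization (h𝔪 : maximalIdeal D = Ideal.span {U, V}) (hrel : α * U ^ 2 + β * U * V + γ * V ^ 2 + η = 0)
    (hη : η ∈ Ideal.span {U, V} ^ 3) (hdisc : IsUnit (β ^ 2 - 4 * α * γ))
    (𝔔 : Ideal (blowupAlgebra (Ideal.span {U, V}) V)) [𝔔.IsPrime]
    (h𝔔 : 𝔔.comap (algebraMap D (blowupAlgebra (Ideal.span {U, V}) V)) = maximalIdeal D)
    (L : Type u) [CommRing L] [Algebra (blowupAlgebra (Ideal.span {U, V}) V) L] [IsLocalization.AtPrime L 𝔔] [IsLocalRing L] :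
    IsRegularLocalRing L := by
  have hmax := maximalIdeal_localization_eq_span U V α β γ η h𝔪 hrel hη hdisc 𝔔 h𝔔 L
  set t := algebraMap (blowupAlgebra (Ideal.span {U, V}) V) L (algebraMap D (blowupAlgebra (Ideal.span {U, V}) V) V) with htdef
  haveI : IsNoetherianRing (blowupAlgebra (Ideal.span {U, V}) V) := isNoetherianRing_blowupAlgebra_of_isNoetherianRing _ _
  haveI : IsNoetherianRing L := IsLocalization.isNoetherianRing 𝔔.primeCompl _ inferInstance
  have ht0 : t ∈ nonZeroDivisors L :=
    map_mem_nonZeroDivisors_of_isLocalization 𝔔.primeCompl L algebraMap_mem_nonZeroDivisors_blowupAlgebra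
  have ht𝔪 : t ∈ maximalIdeal L := by rw [hmax]; exact Ideal.mem_span_singleton_self t
  haveI hmaxI : (Ideal.span {t}).IsMaximal := by rw [← hmax]; exact maximalIdeal.isMaximal _
  letI : Field (L ⧸ Ideal.span {t}) := Ideal.Quotient.field (Ideal.span {t})
  haveI : IsRegularLocalRing (L ⧸ Ideal.span {t}) := inferInstance
  exact isRegularLocalRing_of_quotient_span_singleton ht0 ht𝔪

end Chart

end SplitNodeChart

end Summit.ResolutionOfSingularities.ResolutionOfSingularities.Cruxes.EquisingularLiftNat.Sections.Equinodal

end
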